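import Summits.Langlands.Langlands.Theorems.SqrtFiveQuarticCoversTraceDetTables

/-!
# Tightness of the census `GroupCensusFive`: `H8` and `H12` satisfy its four hypotheses and are
# mutually non-conjugate; the CENSUS §3.3 repair identities — kernel-checked

Route `Langlands/SqrtFiveQuarticCovers` (cell `pub/lg-quartmod`, F-L1).  The route's support item
`GroupCensusFive` (PROVED, `groupCensusFive_proof`) classifies the subgroups `G ≤ GL₂(𝔽₅)` with
(a) `det G ⊆ {±1}`, (b) an element of trace `0` and determinant `-1`, (c) no common `𝔽₅`-eigenline,
(d) determinant-one part not spanning `M₂(𝔽₅)`: `G` is conjugate into `H8 = ⟨diag(2,3), antidiag(1,1)⟩`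
or into `H12 = ⟨(3 1;3 3), diag(1,4)⟩`.  This file records that the classification is TIGHT:

* `H8` and `H12` themselves satisfy (a)–(d) (`det_mem_H8`, `exists_odd_mem_H8`, `irreducible_H8`,
  `span_detOne_H8_ne_top` and the `H12` analogues) — the census is not vacuous and each of its two
  conclusion classes occurs (compare the determinant-`±1` Cartan NORMALISERS, whose determinant-one
  parts span `M₂(𝔽₅)`: `span_detOne_normaliserSplit_eq_top`, `…Nonsplit…` in
  `SqrtFiveQuarticCoversCartanNormaliser`);
* neither class is redundant: `H8` is not conjugate into `H12` and `H12` is not conjugate into `H8`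
  (`not_conj_H8_into_H12`, `not_conj_H12_into_H8`; one-line consequences of the `(trace, det)`
  tables of `SqrtFiveQuarticCoversTraceDetTables`);
* CENSUS §3.3 (the scalar repair of the lifted Atkin–Lehner involutions `θ₃ = g∘w₃`, `θ₇ = g′∘w₇` on
  the refined curves): `3·g² ∈ H8` for `g` diagonal of determinant `±2` and `3·g² ∈ H12` for
  `g ∈ 𝔽₅[a]ˣ` of norm `±2` (`three_mul_sq_mem_H8`, `three_mul_sq_mem_H12`).

Finite group theory / linear algebra over `ZMod 5` only (every residual check a `decide` over at
most four elements of `ZMod 5`); no definitions; standard axioms.  Nothing here is a statement about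
modular curves or elliptic curves.  References: [FreitasLeHungSiksek2015] Remark (iii) after
Cor. 2.1; CENSUS.md §3 of the cell.
-/

set_option linter.dupNamespace false -- project-wide option (lakefile weak.linter.dupNamespace); `Summit.Langlands.Langlands` is the mandated namespace

namespace Summit.Langlands.Langlands.Theorems.GroupCensusFive

open Matrix

/-! ## 1. `H8` and `H12` satisfy the four census hypotheses (a)–(d): the census is not vacuous -/

/-- (a) for `H8`: `det H8 ⊆ {±1}`. [folklore] -/
theorem det_mem_H8 : ∀ g ∈ Subgroup.closure ({(⟨!![2, 0; 0, 3], !![3, 0; 0, 2], by decide, by decide⟩ : GL (Fin 2) (ZMod 5)),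
      (⟨!![0, 1; 1, 0], !![0, 1; 1, 0], by decide, by decide⟩ : GL (Fin 2) (ZMod 5))} : Set (GL (Fin 2) (ZMod 5))),
    Matrix.det ((g : GL (Fin 2) (ZMod 5)) : Matrix (Fin 2) (Fin 2) (ZMod 5)) = 1 ∨
      Matrix.det ((g : GL (Fin 2) (ZMod 5)) : Matrix (Fin 2) (Fin 2) (ZMod 5)) = -1 := by
  intro g hg
  rcases (mem_H8_iff g).1 hg with ⟨-, -, h⟩ | ⟨-, -, h⟩
  exacts [Or.inl h, Or.inr h]

/-- (a) for `H12`: `det H12 ⊆ {±1}`. [folklore] -/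
theorem det_mem_H12 : ∀ g ∈ Subgroup.closure ({(⟨!![3, 1; 3, 3], !![3, 4; 2, 3], by decide, by decide⟩ : GL (Fin 2) (ZMod 5)),
      (⟨!![1, 0; 0, 4], !![1, 0; 0, 4], by decide, by decide⟩ : GL (Fin 2) (ZMod 5))} : Set (GL (Fin 2) (ZMod 5))),
    Matrix.det ((g : GL (Fin 2) (ZMod 5)) : Matrix (Fin 2) (Fin 2) (ZMod 5)) = 1 ∨
      Matrix.det ((g : GL (Fin 2) (ZMod 5)) : Matrix (Fin 2) (Fin 2) (ZMod 5)) = -1 := by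
  intro g hg
  rcases (mem_H12_iff g).1 hg with ⟨-, h⟩ | ⟨-, h⟩
  exacts [Or.inl h, Or.inr h]

/-- (b) for `H8`: `antidiag(1,1) ∈ H8` has trace `0` and determinant `-1`. [folklore] -/
theorem exists_odd_mem_H8 : ∃ c ∈ Subgroup.closure ({(⟨!![2, 0; 0, 3], !![3, 0; 0, 2], by decide, by decide⟩ : GL (Fin 2) (ZMod 5)),
      (⟨!![0, 1; 1, 0], !![0, 1; 1, 0], by decide, by decide⟩ : GL (Fin 2) (ZMod 5))} : Set (GL (Fin 2) (ZMod 5))),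
    Matrix.trace ((c : GL (Fin 2) (ZMod 5)) : Matrix (Fin 2) (Fin 2) (ZMod 5)) = 0 ∧
      Matrix.det ((c : GL (Fin 2) (ZMod 5)) : Matrix (Fin 2) (Fin 2) (ZMod 5)) = -1 :=
  ⟨⟨!![0, 1; 1, 0], !![0, 1; 1, 0], by decide, by decide⟩, Subgroup.subset_closure (by simp),
    by change Matrix.trace (!![0, 1; 1, 0] : Matrix (Fin 2) (Fin 2) (ZMod 5)) = 0; rw [Matrix.trace_fin_two_of]; decide,
    by change Matrix.det (!![0, 1; 1, 0] : Matrix (Fin 2) (Fin 2) (ZMod 5)) = -1; rw [Matrix.det_fin_two_of]; decide⟩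

/-- (b) for `H12`: `f = diag(1,4) ∈ H12` has trace `0` and determinant `-1`. [folklore] -/
theorem exists_odd_mem_H12 : ∃ c ∈ Subgroup.closure ({(⟨!![3, 1; 3, 3], !![3, 4; 2, 3], by decide, by decide⟩ : GL (Fin 2) (ZMod 5)),
      (⟨!![1, 0; 0, 4], !![1, 0; 0, 4], by decide, by decide⟩ : GL (Fin 2) (ZMod 5))} : Set (GL (Fin 2) (ZMod 5))),
    Matrix.trace ((c : GL (Fin 2) (ZMod 5)) : Matrix (Fin 2) (Fin 2) (ZMod 5)) = 0 ∧
      Matrix.det ((c : GL (Fin 2) (ZMod 5)) : Matrix (Fin 2) (Fin 2) (ZMod 5)) = -1 :=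
  ⟨⟨!![1, 0; 0, 4], !![1, 0; 0, 4], by decide, by decide⟩, Subgroup.subset_closure (by simp),
    by change Matrix.trace (!![1, 0; 0, 4] : Matrix (Fin 2) (Fin 2) (ZMod 5)) = 0; rw [Matrix.trace_fin_two_of]; decide,
    by change Matrix.det (!![1, 0; 0, 4] : Matrix (Fin 2) (Fin 2) (ZMod 5)) = -1; rw [Matrix.det_fin_two_of]; decide⟩

/-- (c) for `H8`: no common `𝔽₅`-eigenline (`diag(2,3)` has eigenlines `e₀`, `e₁` only, and
`antidiag(1,1)` swaps them). [folklore] -/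
theorem irreducible_H8 : ¬ ∃ v : Fin 2 → ZMod 5, v ≠ 0 ∧
    ∀ g ∈ Subgroup.closure ({(⟨!![2, 0; 0, 3], !![3, 0; 0, 2], by decide, by decide⟩ : GL (Fin 2) (ZMod 5)),
      (⟨!![0, 1; 1, 0], !![0, 1; 1, 0], by decide, by decide⟩ : GL (Fin 2) (ZMod 5))} : Set (GL (Fin 2) (ZMod 5))),
      ∃ a : ZMod 5, ((g : GL (Fin 2) (ZMod 5)) : Matrix (Fin 2) (Fin 2) (ZMod 5)) *ᵥ v = a • v := by
  rintro ⟨v, hv, hall⟩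
  obtain ⟨l, hl⟩ := hall ⟨!![2, 0; 0, 3], !![3, 0; 0, 2], by decide, by decide⟩ (Subgroup.subset_closure (by simp))
  obtain ⟨m, hm⟩ := hall ⟨!![0, 1; 1, 0], !![0, 1; 1, 0], by decide, by decide⟩ (Subgroup.subset_closure (by simp))
  change (!![2, 0; 0, 3] : Matrix (Fin 2) (Fin 2) (ZMod 5)) *ᵥ v = l • v at hl
  change (!![0, 1; 1, 0] : Matrix (Fin 2) (Fin 2) (ZMod 5)) *ᵥ v = m • v at hm
  apply hv
  have hl0 := congrFun hl 0
  have hl1 := congrFun hl 1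
  have hm0 := congrFun hm 0
  have hm1 := congrFun hm 1
  simp only [Matrix.mulVec, dotProduct, Fin.sum_univ_two, Matrix.of_apply, Matrix.cons_val',
    Matrix.cons_val_zero, Matrix.cons_val_one, Matrix.cons_val_fin_one, Matrix.empty_val',
    Pi.smul_apply, smul_eq_mul] at hl0 hl1 hm0 hm1
  clear hl hm hall
  ext i
  fin_cases i
  · change v 0 = 0
    generalize v 0 = x at *
    generalize v 1 = y at *
    revert x y l m hl0 hl1 hm0 hm1; decide
  · change v 1 = 0
    generalize v 0 = x at *
    generalize v 1 = y at *
    revert x y l m hl0 hl1 hm0 hm1; decide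

/-- (c) for `H12`: no common `𝔽₅`-eigenline (`a = (3 1;3 3)` has irreducible characteristic
polynomial `X² - X + 1`). [folklore] -/
theorem irreducible_H12 : ¬ ∃ v : Fin 2 → ZMod 5, v ≠ 0 ∧
    ∀ g ∈ Subgroup.closure ({(⟨!![3, 1; 3, 3], !![3, 4; 2, 3], by decide, by decide⟩ : GL (Fin 2) (ZMod 5)),
      (⟨!![1, 0; 0, 4], !![1, 0; 0, 4], by decide, by decide⟩ : GL (Fin 2) (ZMod 5))} : Set (GL (Fin 2) (ZMod 5))),
      ∃ a : ZMod 5, ((g : GL (Fin 2) (ZMod 5)) : Matrix (Fin 2) (Fin 2) (ZMod 5)) *ᵥ v = a • v := by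
  rintro ⟨v, hv, hall⟩
  obtain ⟨l, hl⟩ := hall ⟨!![3, 1; 3, 3], !![3, 4; 2, 3], by decide, by decide⟩ (Subgroup.subset_closure (by simp))
  change (!![3, 1; 3, 3] : Matrix (Fin 2) (Fin 2) (ZMod 5)) *ᵥ v = l • v at hl
  apply hv
  have hl0 := congrFun hl 0
  have hl1 := congrFun hl 1
  simp only [Matrix.mulVec, dotProduct, Fin.sum_univ_two, Matrix.of_apply, Matrix.cons_val',
    Matrix.cons_val_zero, Matrix.cons_val_one, Matrix.cons_val_fin_one, Matrix.empty_val',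
    Pi.smul_apply, smul_eq_mul] at hl0 hl1
  clear hl hall
  ext i
  fin_cases i
  · change v 0 = 0
    generalize v 0 = x at *
    generalize v 1 = y at *
    revert x y l hl0 hl1; decide
  · change v 1 = 0
    generalize v 0 = x at *
    generalize v 1 = y at *
    revert x y l hl0 hl1; decide

/-- (d) for `H8`: the determinant-one part of `H8` (the diagonal `diag(u, u⁻¹)`) does NOT span
`M₂(𝔽₅)` — it lies in the diagonal subalgebra; `E₀₁` is missed. [folklore] -/
theorem span_detOne_H8_ne_top :
    Submodule.span (ZMod 5) ((fun g : GL (Fin 2) (ZMod 5) => ((g : GL (Fin 2) (ZMod 5)) : Matrix (Fin 2) (Fin 2) (ZMod 5))) ''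
      {g : GL (Fin 2) (ZMod 5) | g ∈ Subgroup.closure ({(⟨!![2, 0; 0, 3], !![3, 0; 0, 2], by decide, by decide⟩ : GL (Fin 2) (ZMod 5)),
        (⟨!![0, 1; 1, 0], !![0, 1; 1, 0], by decide, by decide⟩ : GL (Fin 2) (ZMod 5))} : Set (GL (Fin 2) (ZMod 5))) ∧
        Matrix.det ((g : GL (Fin 2) (ZMod 5)) : Matrix (Fin 2) (Fin 2) (ZMod 5)) = 1}) ≠ ⊤ := by
  intro h
  let φ : Matrix (Fin 2) (Fin 2) (ZMod 5) →ₗ[ZMod 5] ZMod 5 :=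
    { toFun := fun m => m 0 1
      map_add' := fun _ _ => rfl
      map_smul' := fun _ _ => rfl }
  have hle : Submodule.span (ZMod 5) ((fun g : GL (Fin 2) (ZMod 5) => ((g : GL (Fin 2) (ZMod 5)) : Matrix (Fin 2) (Fin 2) (ZMod 5))) ''
      {g : GL (Fin 2) (ZMod 5) | g ∈ Subgroup.closure ({(⟨!![2, 0; 0, 3], !![3, 0; 0, 2], by decide, by decide⟩ : GL (Fin 2) (ZMod 5)),
        (⟨!![0, 1; 1, 0], !![0, 1; 1, 0], by decide, by decide⟩ : GL (Fin 2) (ZMod 5))} : Set (GL (Fin 2) (ZMod 5))) ∧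
        Matrix.det ((g : GL (Fin 2) (ZMod 5)) : Matrix (Fin 2) (Fin 2) (ZMod 5)) = 1}) ≤ LinearMap.ker φ := by
    rw [Submodule.span_le]
    rintro _ ⟨g, ⟨hg, hd⟩, rfl⟩
    exact ((mem_H8_iff_of_det_eq_one g hd).1 hg).1
  have : (!![0, 1; 0, 0] : Matrix (Fin 2) (Fin 2) (ZMod 5)) ∈ LinearMap.ker φ := hle (h ▸ Submodule.mem_top)
  revert this
  change ((!![0, 1; 0, 0] : Matrix (Fin 2) (Fin 2) (ZMod 5)) 0 1 = 0) → False
  decide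

/-- (d) for `H12`: the determinant-one part of `H12` (`C₆ ⊂ 𝔽₅[a]`) does NOT span `M₂(𝔽₅)` — it
lies in the 2-dimensional algebra `𝔽₅[a] = {(p q; 3q p)}`, killed by `m ↦ m₁₀ - 3 m₀₁`.
[folklore] -/
theorem span_detOne_H12_ne_top :
    Submodule.span (ZMod 5) ((fun g : GL (Fin 2) (ZMod 5) => ((g : GL (Fin 2) (ZMod 5)) : Matrix (Fin 2) (Fin 2) (ZMod 5))) ''
      {g : GL (Fin 2) (ZMod 5) | g ∈ Subgroup.closure ({(⟨!![3, 1; 3, 3], !![3, 4; 2, 3], by decide, by decide⟩ : GL (Fin 2) (ZMod 5)),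
        (⟨!![1, 0; 0, 4], !![1, 0; 0, 4], by decide, by decide⟩ : GL (Fin 2) (ZMod 5))} : Set (GL (Fin 2) (ZMod 5))) ∧
        Matrix.det ((g : GL (Fin 2) (ZMod 5)) : Matrix (Fin 2) (Fin 2) (ZMod 5)) = 1}) ≠ ⊤ := by
  intro h
  let φ : Matrix (Fin 2) (Fin 2) (ZMod 5) →ₗ[ZMod 5] ZMod 5 :=
    { toFun := fun m => m 1 0 - 3 * m 0 1
      map_add' := fun x y => by
        change (x 1 0 + y 1 0) - 3 * (x 0 1 + y 0 1) = (x 1 0 - 3 * x 0 1) + (y 1 0 - 3 * y 0 1)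
        ring
      map_smul' := fun c x => by
        change (c * x 1 0) - 3 * (c * x 0 1) = c * (x 1 0 - 3 * x 0 1)
        ring }
  have hle : Submodule.span (ZMod 5) ((fun g : GL (Fin 2) (ZMod 5) => ((g : GL (Fin 2) (ZMod 5)) : Matrix (Fin 2) (Fin 2) (ZMod 5))) ''
      {g : GL (Fin 2) (ZMod 5) | g ∈ Subgroup.closure ({(⟨!![3, 1; 3, 3], !![3, 4; 2, 3], by decide, by decide⟩ : GL (Fin 2) (ZMod 5)),
        (⟨!![1, 0; 0, 4], !![1, 0; 0, 4], by decide, by decide⟩ : GL (Fin 2) (ZMod 5))} : Set (GL (Fin 2) (ZMod 5))) ∧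
        Matrix.det ((g : GL (Fin 2) (ZMod 5)) : Matrix (Fin 2) (Fin 2) (ZMod 5)) = 1}) ≤ LinearMap.ker φ := by
    rw [Submodule.span_le]
    rintro _ ⟨g, ⟨hg, hd⟩, rfl⟩
    have hc := (mem_H12_iff_of_det_eq_one g hd).1 hg
    obtain ⟨p, q, r, s, hm⟩ := exists_eq_fin_two (g : Matrix (Fin 2) (Fin 2) (ZMod 5))
    rw [hm] at hc
    have h00 := congrArg (fun m : Matrix (Fin 2) (Fin 2) (ZMod 5) => m 0 0) hc
    simp only [Matrix.mul_fin_two, Matrix.of_apply, Matrix.cons_val', Matrix.cons_val_zero,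
      Matrix.cons_val_fin_one, Matrix.empty_val'] at h00
    change (g : Matrix (Fin 2) (Fin 2) (ZMod 5)) 1 0 - 3 * (g : Matrix (Fin 2) (Fin 2) (ZMod 5)) 0 1 = 0
    rw [hm]
    simp only [Matrix.of_apply, Matrix.cons_val', Matrix.cons_val_zero, Matrix.cons_val_one,
      Matrix.cons_val_fin_one, Matrix.empty_val']
    clear hm hc hg hd
    revert p q r h00; decide
  have : (!![0, 0; 1, 0] : Matrix (Fin 2) (Fin 2) (ZMod 5)) ∈ LinearMap.ker φ := hle (h ▸ Submodule.mem_top)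
  revert this
  change ((!![0, 0; 1, 0] : Matrix (Fin 2) (Fin 2) (ZMod 5)) 1 0 - 3 * (!![0, 0; 1, 0] : Matrix (Fin 2) (Fin 2) (ZMod 5)) 0 1 = 0) → False
  decide

/-! ## 2. The dichotomy is irredundant: neither group is conjugate into the other -/

/-- `H8` is not conjugate into `H12`: `diag(2,3) ∈ H8` has determinant `1` and trace `0`, impossible
in `H12` (`trace_ne_zero_of_mem_H12_of_det_eq_one`). [folklore] -/
theorem not_conj_H8_into_H12 : ¬ ∃ x : GL (Fin 2) (ZMod 5),
    ∀ g ∈ Subgroup.closure ({(⟨!![2, 0; 0, 3], !![3, 0; 0, 2], by decide, by decide⟩ : GL (Fin 2) (ZMod 5)),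
      (⟨!![0, 1; 1, 0], !![0, 1; 1, 0], by decide, by decide⟩ : GL (Fin 2) (ZMod 5))} : Set (GL (Fin 2) (ZMod 5))),
      x * g * x⁻¹ ∈ Subgroup.closure ({(⟨!![3, 1; 3, 3], !![3, 4; 2, 3], by decide, by decide⟩ : GL (Fin 2) (ZMod 5)),
        (⟨!![1, 0; 0, 4], !![1, 0; 0, 4], by decide, by decide⟩ : GL (Fin 2) (ZMod 5))} : Set (GL (Fin 2) (ZMod 5))) :=
  not_conj_H12_of_witness_det_one (g := ⟨!![2, 0; 0, 3], !![3, 0; 0, 2], by decide, by decide⟩)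
    (Subgroup.subset_closure (by simp))
    (by change Matrix.det (!![2, 0; 0, 3] : Matrix (Fin 2) (Fin 2) (ZMod 5)) = 1; rw [Matrix.det_fin_two_of]; decide)
    (by change Matrix.trace (!![2, 0; 0, 3] : Matrix (Fin 2) (Fin 2) (ZMod 5)) = 0; rw [Matrix.trace_fin_two_of]; decide)

/-- `H12` is not conjugate into `H8`: `a ∈ H12` has determinant `1` and trace `1`, impossible in
`H8` (`trace_mem_of_mem_H8_of_det_eq_one`). [folklore] -/
theorem not_conj_H12_into_H8 : ¬ ∃ x : GL (Fin 2) (ZMod 5),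
    ∀ g ∈ Subgroup.closure ({(⟨!![3, 1; 3, 3], !![3, 4; 2, 3], by decide, by decide⟩ : GL (Fin 2) (ZMod 5)),
      (⟨!![1, 0; 0, 4], !![1, 0; 0, 4], by decide, by decide⟩ : GL (Fin 2) (ZMod 5))} : Set (GL (Fin 2) (ZMod 5))),
      x * g * x⁻¹ ∈ Subgroup.closure ({(⟨!![2, 0; 0, 3], !![3, 0; 0, 2], by decide, by decide⟩ : GL (Fin 2) (ZMod 5)),
        (⟨!![0, 1; 1, 0], !![0, 1; 1, 0], by decide, by decide⟩ : GL (Fin 2) (ZMod 5))} : Set (GL (Fin 2) (ZMod 5))) :=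
  not_conj_H8_of_witness_det_one (g := ⟨!![3, 1; 3, 3], !![3, 4; 2, 3], by decide, by decide⟩)
    (Subgroup.subset_closure (by simp))
    (by change Matrix.det (!![3, 1; 3, 3] : Matrix (Fin 2) (Fin 2) (ZMod 5)) = 1; rw [Matrix.det_fin_two_of]; decide)
    (Or.inl (by change Matrix.trace (!![3, 1; 3, 3] : Matrix (Fin 2) (Fin 2) (ZMod 5)) = 1; rw [Matrix.trace_fin_two_of]; decide))

/-! ## 3. CENSUS §3.3: the scalar repair of the lifted Atkin–Lehner involutions -/

/-- **`3·g² ∈ H8` for `g` diagonal of determinant `±2`** (CENSUS §3.3: `θ₃ = g ∘ w₃` on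
`X(b3, H8, …)` squares to the action of `3g² ∈ H8`, e.g. `3·diag(1,2)² = diag(3,2)`). [folklore] -/
theorem three_mul_sq_mem_H8 (g : GL (Fin 2) (ZMod 5))
    (hdiag : (g : Matrix (Fin 2) (Fin 2) (ZMod 5)) 0 1 = 0 ∧ (g : Matrix (Fin 2) (Fin 2) (ZMod 5)) 1 0 = 0)
    (hdet : Matrix.det (g : Matrix (Fin 2) (Fin 2) (ZMod 5)) = 2 ∨ Matrix.det (g : Matrix (Fin 2) (Fin 2) (ZMod 5)) = -2) :
    (⟨!![3, 0; 0, 3], !![2, 0; 0, 2], by decide, by decide⟩ : GL (Fin 2) (ZMod 5)) * g * g ∈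
      Subgroup.closure ({(⟨!![2, 0; 0, 3], !![3, 0; 0, 2], by decide, by decide⟩ : GL (Fin 2) (ZMod 5)),
        (⟨!![0, 1; 1, 0], !![0, 1; 1, 0], by decide, by decide⟩ : GL (Fin 2) (ZMod 5))} : Set (GL (Fin 2) (ZMod 5))) := by
  apply mem_H8_of_shape
  left
  obtain ⟨p, q, r, s, hm⟩ := exists_eq_fin_two (g : Matrix (Fin 2) (Fin 2) (ZMod 5))
  rw [Units.val_mul, Units.val_mul, hm]
  rw [hm] at hdiag hdet
  rw [Matrix.det_fin_two_of] at hdet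
  simp only [Matrix.of_apply, Matrix.cons_val', Matrix.cons_val_zero, Matrix.cons_val_one,
    Matrix.cons_val_fin_one, Matrix.empty_val'] at hdiag
  obtain ⟨rfl, rfl⟩ := hdiag
  change (!![3, 0; 0, 3] : Matrix (Fin 2) (Fin 2) (ZMod 5)) * !![p, 0; 0, s] * !![p, 0; 0, s] ∈
    {u : Matrix (Fin 2) (Fin 2) (ZMod 5) | u 0 1 = 0 ∧ u 1 0 = 0 ∧ Matrix.det u = 1}
  simp only [Matrix.mul_fin_two, Set.mem_setOf_eq, Matrix.det_fin_two_of, Matrix.of_apply, Matrix.cons_val',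
    Matrix.cons_val_zero, Matrix.cons_val_one, Matrix.cons_val_fin_one, Matrix.empty_val']
  clear hm
  revert p s hdet; decide

/-- **`3·g² ∈ H12` for `g ∈ 𝔽₅[a]ˣ` (commuting with `a`) of norm (determinant) `±2`** (CENSUS §3.3:
the repair of `w₃`, `w₇` on `X(…, H12, …)`: `3g²` has norm `9·4 = 1`, so lies in `C₆ ⊂ H12`).
[folklore] -/
theorem three_mul_sq_mem_H12 (g : GL (Fin 2) (ZMod 5))
    (hcomm : (g : Matrix (Fin 2) (Fin 2) (ZMod 5)) * !![3, 1; 3, 3] = !![3, 1; 3, 3] * (g : Matrix (Fin 2) (Fin 2) (ZMod 5)))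
    (hdet : Matrix.det (g : Matrix (Fin 2) (Fin 2) (ZMod 5)) = 2 ∨ Matrix.det (g : Matrix (Fin 2) (Fin 2) (ZMod 5)) = -2) :
    (⟨!![3, 0; 0, 3], !![2, 0; 0, 2], by decide, by decide⟩ : GL (Fin 2) (ZMod 5)) * g * g ∈
      Subgroup.closure ({(⟨!![3, 1; 3, 3], !![3, 4; 2, 3], by decide, by decide⟩ : GL (Fin 2) (ZMod 5)),
        (⟨!![1, 0; 0, 4], !![1, 0; 0, 4], by decide, by decide⟩ : GL (Fin 2) (ZMod 5))} : Set (GL (Fin 2) (ZMod 5))) := by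
  apply mem_H12_of_shape
  left
  have h3 : (!![3, 0; 0, 3] : Matrix (Fin 2) (Fin 2) (ZMod 5)) * !![3, 1; 3, 3] = !![3, 1; 3, 3] * !![3, 0; 0, 3] := by decide
  refine ⟨?_, ?_⟩
  · rw [Units.val_mul, Units.val_mul]
    change (!![3, 0; 0, 3] : Matrix (Fin 2) (Fin 2) (ZMod 5)) * (g : Matrix (Fin 2) (Fin 2) (ZMod 5)) * (g : Matrix (Fin 2) (Fin 2) (ZMod 5)) * !![3, 1; 3, 3] =
      !![3, 1; 3, 3] * ((!![3, 0; 0, 3] : Matrix (Fin 2) (Fin 2) (ZMod 5)) * (g : Matrix (Fin 2) (Fin 2) (ZMod 5)) * (g : Matrix (Fin 2) (Fin 2) (ZMod 5)))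
    rw [Matrix.mul_assoc, Matrix.mul_assoc, hcomm, ← Matrix.mul_assoc (g : Matrix (Fin 2) (Fin 2) (ZMod 5)), hcomm,
      Matrix.mul_assoc, ← Matrix.mul_assoc, ← Matrix.mul_assoc, h3, Matrix.mul_assoc, Matrix.mul_assoc, Matrix.mul_assoc]
  · rw [Units.val_mul, Units.val_mul, Matrix.det_mul, Matrix.det_mul]
    change Matrix.det (!![3, 0; 0, 3] : Matrix (Fin 2) (Fin 2) (ZMod 5)) * _ * _ = 1
    rw [Matrix.det_fin_two_of]
    generalize Matrix.det (g : Matrix (Fin 2) (Fin 2) (ZMod 5)) = d at hdet ⊢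
    revert d; decide

end Summit.Langlands.Langlands.Theorems.GroupCensusFive
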